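import Summits.Ventures.PercRepro.MSTightDichotomy

/-!
# Closure properties of tight families with a down-closed difference family

`MSTightDichotomy.lean` (Theorem D): if `F` is Marica–Schönheim-tight and `F \\ F` is a down-set,
then every coordinate `s` is ADDABLE (every member avoiding `s` has `insert s A ∈ F`) or DELETABLE
(every member containing `s` has `A.erase s ∈ F`). This file records the consequences used by the
six-class analysis of proofs/P4-gen9.md §9–§10 (FACT (M)):

* `Addable` / `Deletable` and `addable_or_deletable` (Theorem D restated);
* `union_mem_of_addable` / `sdiff_mem_of_deletable`: `F` is closed under adding any finset of
  addable coordinates and deleting any finset of deletable ones (induction on the finset);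
* `addableSet u F`, the addable coordinates of a support `u`, and
  `addableSet_mem`: the addable class itself is a member (`M′ ∈ F′` in §9);
* `inter_addableSet_mem` / `union_addableSet_mem`: for every member `A`, `A ∩ M′ ∈ F` and
  `A ∪ M′ ∈ F` — the interval `[A ∩ M′, A ∪ M′]` of §9.
-/

namespace PercRepro.MSTight

open Finset
open scoped FinsetFamily

variable {α : Type*} [DecidableEq α]

/-- A coordinate `s` is **addable** in `F` when every member avoiding `s` has its `s`-extension
in `F`. -/
def Addable (F : Finset (Finset α)) (s : α) : Prop := ∀ A ∈ F, s ∉ A → insert s A ∈ F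

/-- A coordinate `s` is **deletable** in `F` when every member containing `s` has its
`s`-deletion in `F`. -/
def Deletable (F : Finset (Finset α)) (s : α) : Prop := ∀ A ∈ F, s ∈ A → A.erase s ∈ F

/-- **Theorem D restated**: in a tight family with a down-closed difference family every
coordinate is addable or deletable. -/
theorem addable_or_deletable {F : Finset (Finset α)} (hF : Tight F) (hD : IsDownSet (F \\ F))
    (s : α) : Addable F s ∨ Deletable F s :=
  forall_insert_mem_or_forall_erase_mem hF hD s

/-- Adding any finset of addable coordinates keeps a member in `F`. -/
theorem union_mem_of_addable {F : Finset (Finset α)} {A : Finset α} (hA : A ∈ F) (M : Finset α)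
    (hM : ∀ s ∈ M, Addable F s) : A ∪ M ∈ F := by
  induction M using Finset.induction_on with
  | empty => simpa using hA
  | insert s M hs ih =>
    have hM' : ∀ t ∈ M, Addable F t := fun t ht => hM t (Finset.mem_insert_of_mem ht)
    have h1 : A ∪ M ∈ F := ih hM'
    by_cases hsA : s ∈ A ∪ M
    · have : A ∪ insert s M = A ∪ M := by
        ext x
        simp only [Finset.mem_union, Finset.mem_insert]
        constructor
        · rintro (hx | rfl | hx)
          · exact Or.inl hx
          · exact Finset.mem_union.1 hsA
          · exact Or.inr hx
        · rintro (hx | hx)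
          · exact Or.inl hx
          · exact Or.inr (Or.inr hx)
      rw [this]; exact h1
    · have : A ∪ insert s M = insert s (A ∪ M) := by
        ext x
        simp only [Finset.mem_union, Finset.mem_insert]
        tauto
      rw [this]
      exact hM s (Finset.mem_insert_self s M) (A ∪ M) h1 hsA

/-- Deleting any finset of deletable coordinates keeps a member in `F`. -/
theorem sdiff_mem_of_deletable {F : Finset (Finset α)} {A : Finset α} (hA : A ∈ F) (N : Finset α)
    (hN : ∀ s ∈ N, Deletable F s) : A \ N ∈ F := by
  induction N using Finset.induction_on with
  | empty => simpa using hA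
  | insert s N hs ih =>
    have hN' : ∀ t ∈ N, Deletable F t := fun t ht => hN t (Finset.mem_insert_of_mem ht)
    have h1 : A \ N ∈ F := ih hN'
    have hsd : A \ insert s N = (A \ N).erase s := by
      ext x
      simp only [Finset.mem_sdiff, Finset.mem_insert, Finset.mem_erase, not_or]
      tauto
    rw [hsd]
    by_cases hsA : s ∈ A \ N
    · exact hN s (Finset.mem_insert_self s N) (A \ N) h1 hsA
    · rw [Finset.erase_eq_of_notMem hsA]; exact h1

open Classical in
/-- The addable coordinates of a support `u`. -/
noncomputable def addableSet (u : Finset α) (F : Finset (Finset α)) : Finset α :=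
  u.filter fun s => Addable F s

open Classical in
/-- Membership in the addable class. -/
theorem mem_addableSet {u : Finset α} {F : Finset (Finset α)} {s : α} :
    s ∈ addableSet u F ↔ s ∈ u ∧ Addable F s := by
  simp [addableSet]

open Classical in
/-- Every coordinate of the support outside the addable class is deletable (tight, down-closed). -/
theorem deletable_of_notMem_addableSet {u : Finset α} {F : Finset (Finset α)} (hF : Tight F)
    (hD : IsDownSet (F \\ F)) {s : α} (hs : s ∈ u) (h : s ∉ addableSet u F) : Deletable F s := by
  rcases addable_or_deletable hF hD s with ha | hd
  · exact absurd (mem_addableSet.2 ⟨hs, ha⟩) h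
  · exact hd

open Classical in
/-- **`A ∩ M′ ∈ F`** for every member `A` (delete the non-addable coordinates). -/
theorem inter_addableSet_mem {u : Finset α} {F : Finset (Finset α)} (hF : Tight F)
    (hD : IsDownSet (F \\ F)) (hFu : ∀ A ∈ F, A ⊆ u) {A : Finset α} (hA : A ∈ F) :
    A ∩ addableSet u F ∈ F := by
  have h := sdiff_mem_of_deletable hA (u \ addableSet u F) (fun s hs =>
    deletable_of_notMem_addableSet hF hD (Finset.mem_sdiff.1 hs).1 (Finset.mem_sdiff.1 hs).2)
  have : A \ (u \ addableSet u F) = A ∩ addableSet u F := by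
    ext x
    simp only [Finset.mem_sdiff, Finset.mem_inter, not_and, not_not]
    constructor
    · rintro ⟨hxA, hx⟩
      exact ⟨hxA, hx (hFu A hA hxA)⟩
    · rintro ⟨hxA, hx⟩
      exact ⟨hxA, fun _ => hx⟩
  rw [← this]; exact h

open Classical in
/-- **`A ∪ M′ ∈ F`** for every member `A` (add the addable coordinates). -/
theorem union_addableSet_mem {u : Finset α} {F : Finset (Finset α)} {A : Finset α} (hA : A ∈ F) :
    A ∪ addableSet u F ∈ F :=
  union_mem_of_addable hA _ (fun _ hs => (mem_addableSet.1 hs).2)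

open Classical in
/-- **The addable class is a member**: `M′ ∈ F` whenever `F` is nonempty (tight, down-closed,
support `u`). -/
theorem addableSet_mem {u : Finset α} {F : Finset (Finset α)} (hF : Tight F)
    (hD : IsDownSet (F \\ F)) (hFu : ∀ A ∈ F, A ⊆ u) (hne : F.Nonempty) : addableSet u F ∈ F := by
  obtain ⟨A, hA⟩ := hne
  have h1 := union_addableSet_mem (u := u) hA
  have h2 := inter_addableSet_mem hF hD hFu h1
  have : (A ∪ addableSet u F) ∩ addableSet u F = addableSet u F := by
    ext x; simp only [Finset.mem_inter, Finset.mem_union]; tauto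
  rw [this] at h2
  exact h2

end PercRepro.MSTight
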